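import Summits.CriticalPhenomena.PercolationContinuityZ3.Theorems.PercNearOneGluingNoHeavyLowerTailSunflowerTBern
import HarnessLib

/-!
# `NoHeavyLowerTail` (crux stmt-CriticalPhenomena-4575), abstract sunflower cubic: T-BERN as coefficientwise domination
# of polynomials, and the SEQUENTIAL ABSORPTION SCHEME

Support file (seat `prim-ineq-prove-1` gen 63; `--supports stmt-CriticalPhenomena-4575`).  No `sorry`, no named facts, no
conjecture-shaped hypotheses.  Memo: run/shared/lean/prim/prim-ineq-prove-1/FINDING-CONVEX-prove1-g63.md §4.

`TBern s b β V` (`…SunflowerTBern`) asks that the `tcoeff`s of the family polynomial `∏_j (A_j X + g_j)` be dominated one by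
one by those of the comparison family {full petal, floors}.  Here that statement is recast as honest polynomial algebra over
`ℝ[X]`:
* `prodPoly s a c = ∏_{i∈s} (C (a i)·X + C (c i))` and **`coeff_prodPoly`**: its `k`-th coefficient is `tcoeff s a c k`;
* `CoefDom p q` (every coefficient of `p` is `≤` the corresponding one of `q`) and `CoefNonneg`; domination is preserved by
  multiplication with a polynomial with nonnegative coefficients (`CoefDom.mul_left/right`);
* **the absorption step** `coefDom_step`: `(A X + G)(a X + c) ≤_coef (F₁X + F₀)(A′X + G′)` as soon as `Aa ≤ F₁A′`,
  `Gc ≤ F₀G′`, `Ac + Ga ≤ F₁G′ + F₀A′`; hence (**`coefDom_prodPoly_insert`**) the invariant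
  `∏_{i∈s}(a_iX + c_i) ≤_coef (F₁X+F₀)^(|s|−1)·(A X + G)` propagates from `s` to `insert j s` with the new virtual state
  `(A′, G′)` — the "sequential scheme" of the memo (aligned petals: `A′ = Aa/F₁`, `G′ = Gc/F₀`; misaligned ones need the
  inflation `Δ = (A/F₁ − G/F₀)(c/F₀ − a/F₁)`-type corrections, chosen by the user of the lemma);
* **`prodPoly_fullFloor`** and **`tbern_le_of_coefDom`**: the comparison family's polynomial IS `(A₀X + a₀)^(n−1)(X + V)`, so a
  `CoefDom` certificate for a family gives exactly the `tcoeff` inequality that `TBern` demands for it; `tbern_of_coefDom`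
  packages this: `TBern s b β V` follows from a `CoefDom` certificate for every admissible family.
So a proof of T-BERN (hence of `CappedPendant`, hence of (RES0′) for all `n`, via `cappedPendant_of_tbern` and
`res0_of_cappedPendant`) may be organised as: order the petals, run the virtual state `(A, G)` through `coefDom_step`, and
check `A_fin ≤ 1`, `G_fin ≤ V` at the end (numerically this never fails with the global greedy policy, memo §4).
-/

noncomputable section

namespace Summit.CriticalPhenomena.PercolationContinuityZ3.Theorems.SunflowerPartition

namespace SafeCalc

namespace LinkedCurrency

open Finset Polynomial

variable {ι : Type*} [DecidableEq ι]

/-! ## The family polynomial and its coefficients -/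

/-- The family polynomial `∏_{i ∈ s} (a_i X + c_i) ∈ ℝ[X]`. [this work] -/
def prodPoly (s : Finset ι) (a c : ι → ℝ) : ℝ[X] := ∏ i ∈ s, (C (a i) * X + C (c i))

/-- **The `k`-th coefficient of the family polynomial is `tcoeff s a c k`.** [this work] -/
theorem coeff_prodPoly (s : Finset ι) (a c : ι → ℝ) (k : ℕ) : (prodPoly s a c).coeff k = tcoeff s a c k := by
  unfold prodPoly tcoeff
  rw [prod_add, finsetSum_coeff]
  have h : ∀ t ∈ s.powerset, ((∏ i ∈ t, C (a i) * X) * ∏ i ∈ s \ t, C (c i)).coeff k =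
      if t.card = k then (∏ i ∈ t, a i) * ∏ i ∈ s \ t, c i else 0 := by
    intro t _
    rw [prod_mul_distrib, prod_const, ← map_prod C, ← map_prod C]
    rw [show C (∏ i ∈ t, a i) * X ^ t.card * C (∏ i ∈ s \ t, c i) =
        C ((∏ i ∈ t, a i) * ∏ i ∈ s \ t, c i) * X ^ t.card by rw [C_mul]; ring]
    rw [coeff_C_mul_X_pow]
    by_cases hk : t.card = k
    · simp [hk]
    · simp [hk, Ne.symm hk]
  rw [sum_congr rfl h, ← sum_filter, powersetCard_eq_filter]

/-- The family polynomial of `insert j s`. [this work] -/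
theorem prodPoly_insert {s : Finset ι} {j : ι} (hj : j ∉ s) (a c : ι → ℝ) :
    prodPoly (insert j s) a c = (C (a j) * X + C (c j)) * prodPoly s a c := by
  unfold prodPoly; rw [prod_insert hj]

omit [DecidableEq ι] in
/-- The family polynomial of a singleton. [this work] -/
theorem prodPoly_singleton (j : ι) (a c : ι → ℝ) : prodPoly {j} a c = C (a j) * X + C (c j) := by
  unfold prodPoly; rw [prod_singleton]

/-- The coefficients of the empty family: the constant polynomial `1`. [this work] -/
theorem tcoeff_empty (a c : ι → ℝ) (k : ℕ) : tcoeff (∅ : Finset ι) a c k = if k = 0 then 1 else 0 := by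
  unfold tcoeff
  rcases k with _ | k
  · simp
  · rw [powersetCard_eq_empty.2 (by simp), sum_empty]
    simp

/-! ## Coefficientwise domination -/

/-- `p ≤ q` coefficient by coefficient (a predicate on two real polynomials). [definition, this work] -/
def CoefDom (p q : ℝ[X]) : Prop := ∀ k, p.coeff k ≤ q.coeff k

/-- All coefficients of `p` are nonnegative (a predicate on a real polynomial). [definition, this work] -/
def CoefNonneg (p : ℝ[X]) : Prop := ∀ k, 0 ≤ p.coeff k

/-- Reflexivity. [this work] -/
theorem CoefDom.rfl {p : ℝ[X]} : CoefDom p p := fun _ => le_rfl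

/-- Transitivity. [this work] -/
theorem CoefDom.trans {p q r : ℝ[X]} (h₁ : CoefDom p q) (h₂ : CoefDom q r) : CoefDom p r :=
  fun k => (h₁ k).trans (h₂ k)

/-- Domination along an equality on the left. [this work] -/
theorem CoefDom.of_eq_left {p p' q : ℝ[X]} (h : CoefDom p q) (he : p' = p) : CoefDom p' q := by rw [he]; exact h

/-- Domination along an equality on the right. [this work] -/
theorem CoefDom.of_eq_right {p q q' : ℝ[X]} (h : CoefDom p q) (he : q' = q) : CoefDom p q' := by rw [he]; exact h

/-- Multiplying by a polynomial with nonnegative coefficients on the right preserves domination. [this work] -/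
theorem CoefDom.mul_right {p q r : ℝ[X]} (h : CoefDom p q) (hr : CoefNonneg r) : CoefDom (p * r) (q * r) := by
  intro k
  rw [coeff_mul, coeff_mul]
  exact sum_le_sum fun x _ => mul_le_mul_of_nonneg_right (h _) (hr _)

/-- Multiplying by a polynomial with nonnegative coefficients on the left preserves domination. [this work] -/
theorem CoefDom.mul_left {p q r : ℝ[X]} (h : CoefDom p q) (hr : CoefNonneg r) : CoefDom (r * p) (r * q) := by
  intro k
  rw [coeff_mul, coeff_mul]
  exact sum_le_sum fun x _ => mul_le_mul_of_nonneg_left (h _) (hr _)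

/-- Products of polynomials with nonnegative coefficients have nonnegative coefficients. [this work] -/
theorem CoefNonneg.mul {p q : ℝ[X]} (hp : CoefNonneg p) (hq : CoefNonneg q) : CoefNonneg (p * q) := by
  intro k
  rw [coeff_mul]
  exact sum_nonneg fun x _ => mul_nonneg (hp _) (hq _)

/-- Powers of a polynomial with nonnegative coefficients have nonnegative coefficients. [this work] -/
theorem CoefNonneg.pow {p : ℝ[X]} (hp : CoefNonneg p) (n : ℕ) : CoefNonneg (p ^ n) := by
  induction n with
  | zero =>
    intro k
    rw [pow_zero, coeff_one]
    split_ifs <;> norm_num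
  | succ n ih =>
    rw [pow_succ]
    exact ih.mul hp

/-- A linear polynomial `aX + c` with `a, c ≥ 0` has nonnegative coefficients. [this work] -/
theorem coefNonneg_lin {a c : ℝ} (ha : 0 ≤ a) (hc : 0 ≤ c) : CoefNonneg (C a * X + C c) := by
  intro k
  rw [coeff_add, coeff_C_mul, coeff_X, coeff_C]
  split_ifs <;> nlinarith

/-- Domination of linear polynomials is domination of the two coefficients. [this work] -/
theorem coefDom_lin {a c A G : ℝ} (ha : a ≤ A) (hc : c ≤ G) : CoefDom (C a * X + C c) (C A * X + C G) := by
  intro k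
  rw [coeff_add, coeff_C_mul, coeff_X, coeff_C, coeff_add, coeff_C_mul, coeff_X, coeff_C]
  split_ifs <;> nlinarith

/-- The coefficients of a quadratic `C u * X^2 + C v * X + C w`. [this work] -/
theorem coeff_quadratic (u v w : ℝ) (k : ℕ) :
    (C u * X ^ 2 + C v * X + C w).coeff k = if k = 2 then u else if k = 1 then v else if k = 0 then w else 0 := by
  rw [coeff_add, coeff_add, coeff_C_mul, coeff_X_pow, coeff_C_mul, coeff_X, coeff_C]
  rcases k with _ | _ | _ | k
  · simp
  · simp
  · simp
  · simp

/-! ## The absorption step -/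

/-- **The absorption step.**  If `Aa ≤ F₁A′`, `Gc ≤ F₀G′` and `Ac + Ga ≤ F₁G′ + F₀A′`, then
`(A X + G)(a X + c) ≤_coef (F₁ X + F₀)(A′ X + G′)`.  (Normalised floors `F₁ = F₀ = 1`: an aligned pair, `(A−G)(a−c) ≥ 0`,
may take `A′ = Aa`, `G′ = Gc`; a misaligned pair needs `A′ + G′ ≥ Aa + Gc + |A−G||a−c|`.) [this work] -/
theorem coefDom_step {A G a c F₁ F₀ A' G' : ℝ} (h2 : A * a ≤ F₁ * A') (h0 : G * c ≤ F₀ * G')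
    (h1 : A * c + G * a ≤ F₁ * G' + F₀ * A') :
    CoefDom ((C A * X + C G) * (C a * X + C c)) ((C F₁ * X + C F₀) * (C A' * X + C G')) := by
  intro k
  have e1 : (C A * X + C G) * (C a * X + C c) = C (A * a) * X ^ 2 + C (A * c + G * a) * X + C (G * c) := by
    rw [C_mul, C_add, C_mul, C_mul, C_mul]; ring
  have e2 : (C F₁ * X + C F₀) * (C A' * X + C G') =
      C (F₁ * A') * X ^ 2 + C (F₁ * G' + F₀ * A') * X + C (F₀ * G') := by
    rw [C_mul, C_add, C_mul, C_mul, C_mul]; ring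
  rw [e1, e2, coeff_quadratic, coeff_quadratic]
  split_ifs <;> first | exact h2 | exact h1 | exact h0 | exact le_rfl

/-- **The scheme invariant propagates.**  If `∏_{i∈s}(a_iX+c_i) ≤_coef (F₁X+F₀)^(|s|−1)(AX+G)` for a nonempty `s`,
`j ∉ s`, `a_j, c_j, F₁, F₀ ≥ 0`, and the step conditions `Aa_j ≤ F₁A′`, `Gc_j ≤ F₀G′`, `Ac_j + Ga_j ≤ F₁G′ + F₀A′` hold,
then `∏_{i ∈ insert j s}(a_iX+c_i) ≤_coef (F₁X+F₀)^(|insert j s|−1)(A′X+G′)`. [this work] -/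
theorem coefDom_prodPoly_insert {s : Finset ι} {j : ι} (hj : j ∉ s) (hs : s.Nonempty) {a c : ι → ℝ}
    {F₁ F₀ A G A' G' : ℝ} (hF₁ : 0 ≤ F₁) (hF₀ : 0 ≤ F₀) (ha : 0 ≤ a j) (hc : 0 ≤ c j)
    (hdom : CoefDom (prodPoly s a c) ((C F₁ * X + C F₀) ^ (s.card - 1) * (C A * X + C G)))
    (h2 : A * a j ≤ F₁ * A') (h0 : G * c j ≤ F₀ * G') (h1 : A * c j + G * a j ≤ F₁ * G' + F₀ * A') :
    CoefDom (prodPoly (insert j s) a c) ((C F₁ * X + C F₀) ^ ((insert j s).card - 1) * (C A' * X + C G')) := by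
  have hcard : (insert j s).card - 1 = (s.card - 1) + 1 := by
    rw [card_insert_of_notMem hj]
    have := hs.card_pos
    omega
  rw [prodPoly_insert hj, hcard, pow_succ]
  have hlin : CoefNonneg (C (a j) * X + C (c j)) := coefNonneg_lin ha hc
  have hpow : CoefNonneg ((C F₁ * X + C F₀) ^ (s.card - 1)) := (coefNonneg_lin hF₁ hF₀).pow _
  have step1 : CoefDom ((C (a j) * X + C (c j)) * prodPoly s a c)
      ((C (a j) * X + C (c j)) * ((C F₁ * X + C F₀) ^ (s.card - 1) * (C A * X + C G))) := hdom.mul_left hlin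
  have step2 : CoefDom ((C F₁ * X + C F₀) ^ (s.card - 1) * ((C A * X + C G) * (C (a j) * X + C (c j))))
      ((C F₁ * X + C F₀) ^ (s.card - 1) * ((C F₁ * X + C F₀) * (C A' * X + C G'))) :=
    (coefDom_step h2 h0 h1).mul_left hpow
  refine (step1.trans (step2.of_eq_left ?_)).of_eq_right ?_
  · ring
  · ring

omit [DecidableEq ι] in
/-- **Base of the scheme**: a single petal `(a_j, c_j)` is dominated by the virtual state `(A, G)` iff `a_j ≤ A`, `c_j ≤ G`.
[this work] -/
theorem coefDom_prodPoly_singleton {j : ι} {a c : ι → ℝ} {F₁ F₀ A G : ℝ} (ha : a j ≤ A) (hc : c j ≤ G) :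
    CoefDom (prodPoly {j} a c) ((C F₁ * X + C F₀) ^ (({j} : Finset ι).card - 1) * (C A * X + C G)) := by
  rw [prodPoly_singleton, card_singleton, Nat.sub_self, pow_zero, one_mul]
  exact coefDom_lin ha hc

/-- **Floor petals are free**: if petal `j` IS the floor `(F₁, F₀)`, the invariant propagates with the same state. [this work] -/
theorem coefDom_prodPoly_insert_floor {s : Finset ι} {j : ι} (hj : j ∉ s) (hs : s.Nonempty) {a c : ι → ℝ}
    {F₁ F₀ A G : ℝ} (hF₁ : 0 ≤ F₁) (hF₀ : 0 ≤ F₀) (haj : a j = F₁) (hcj : c j = F₀)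
    (hdom : CoefDom (prodPoly s a c) ((C F₁ * X + C F₀) ^ (s.card - 1) * (C A * X + C G))) :
    CoefDom (prodPoly (insert j s) a c) ((C F₁ * X + C F₀) ^ ((insert j s).card - 1) * (C A * X + C G)) := by
  refine coefDom_prodPoly_insert hj hs hF₁ hF₀ (haj ▸ hF₁) (hcj ▸ hF₀) hdom ?_ ?_ ?_
  · rw [haj, mul_comm]
  · rw [hcj, mul_comm]
  · rw [haj, hcj]; nlinarith

/-! ## Aligned families (normalised floors): coefficientwise merging -/

/-- **Aligned merging, coefficientwise.**  For a nonempty family with `a_i, c_i ≥ 1` all on one side of the diagonal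
(`c_i ≤ a_i` for all `i`, or `a_i ≤ c_i` for all `i`), `∏(a_iX + c_i) ≤_coef (X+1)^(|s|−1)((∏a)X + ∏c)`: the virtual merge
of an aligned class is legitimate coefficient by coefficient (this is the coefficientwise form of `prod_pfun_le_merged`).
[this work] -/
theorem coefDom_prodPoly_aligned (s : Finset ι) (hs : s.Nonempty) (a c : ι → ℝ) (ha : ∀ i ∈ s, 1 ≤ a i)
    (hc : ∀ i ∈ s, 1 ≤ c i)
    (hal : (∀ i ∈ s, c i ≤ a i) ∨ (∀ i ∈ s, a i ≤ c i)) :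
    CoefDom (prodPoly s a c) ((C 1 * X + C 1) ^ (s.card - 1) * (C (∏ i ∈ s, a i) * X + C (∏ i ∈ s, c i))) := by
  classical
  induction s using Finset.induction_on with
  | empty => exact absurd hs Finset.not_nonempty_empty
  | @insert j s hj ih =>
    rcases s.eq_empty_or_nonempty with hse | hsne
    · subst hse
      rw [LawfulSingleton.insert_empty_eq, prod_singleton, prod_singleton]
      exact coefDom_prodPoly_singleton le_rfl le_rfl
    have ha' : ∀ i ∈ s, 1 ≤ a i := fun i hi => ha i (mem_insert_of_mem hi)
    have hc' : ∀ i ∈ s, 1 ≤ c i := fun i hi => hc i (mem_insert_of_mem hi)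
    have hal' : (∀ i ∈ s, c i ≤ a i) ∨ (∀ i ∈ s, a i ≤ c i) :=
      hal.imp (fun h i hi => h i (mem_insert_of_mem hi)) (fun h i hi => h i (mem_insert_of_mem hi))
    have key := ih hsne ha' hc' hal'
    rw [prod_insert hj, prod_insert hj]
    have hA1 : 1 ≤ ∏ i ∈ s, a i := Pendant.one_le_prod_of_one_le s ha'
    have hG1 : 1 ≤ ∏ i ∈ s, c i := Pendant.one_le_prod_of_one_le s hc'
    have haj : 1 ≤ a j := ha j (mem_insert_self j s)
    have hcj : 1 ≤ c j := hc j (mem_insert_self j s)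
    refine coefDom_prodPoly_insert hj hsne zero_le_one zero_le_one (zero_le_one.trans haj) (zero_le_one.trans hcj)
      key ?_ ?_ ?_
    · rw [one_mul, mul_comm]
    · rw [one_mul, mul_comm]
    · -- alignment: (A − G)(a_j − c_j) ≥ 0 with A = ∏a, G = ∏c
      have hsign : 0 ≤ ((∏ i ∈ s, a i) - ∏ i ∈ s, c i) * (a j - c j) := by
        rcases hal with h | h
        · exact mul_nonneg (sub_nonneg.2 (prod_le_prod (fun i hi => zero_le_one.trans (hc' i hi))
            (fun i hi => h i (mem_insert_of_mem hi)))) (sub_nonneg.2 (h j (mem_insert_self j s)))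
        · exact mul_nonneg_of_nonpos_of_nonpos (sub_nonpos.2 (prod_le_prod (fun i hi => zero_le_one.trans (ha' i hi))
            (fun i hi => h i (mem_insert_of_mem hi)))) (sub_nonpos.2 (h j (mem_insert_self j s)))
      nlinarith [hsign]

/-! ## The comparison family and the bridge to `TBern` -/

/-- The comparison family {full petal at `0`, floors elsewhere} has polynomial `(A₀X + a₀)^(n−1)·(X + V)`. [this work] -/
theorem prodPoly_fullFloor (s b β V : ℝ) (n : ℕ) (hn : 0 < n) :
    prodPoly univ (fullFloorA s b (n := n)) (fullFloorG s b β V) =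
      (C (s + (1 - s) * b) * X + C ((1 - s) * b + s * β)) ^ (n - 1) * (C 1 * X + C V) := by
  obtain ⟨n', rfl⟩ : ∃ n', n = n' + 1 := ⟨n - 1, by omega⟩
  unfold prodPoly
  rw [Fin.prod_univ_succ]
  have h0 : C (fullFloorA s b (0 : Fin (n' + 1))) * X + C (fullFloorG s b β V (0 : Fin (n' + 1))) = C 1 * X + C V := by
    simp [fullFloorA, fullFloorG]
  have hsucc : ∀ i : Fin n', C (fullFloorA s b i.succ) * X + C (fullFloorG s b β V i.succ) =
      C (s + (1 - s) * b) * X + C ((1 - s) * b + s * β) := by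
    intro i
    have hne : ((i.succ : Fin (n' + 1)) : ℕ) ≠ 0 := by simp [Fin.val_succ]
    simp only [fullFloorA, fullFloorG, hne, if_false]
  rw [h0, prod_congr rfl fun i _ => hsucc i, prod_const, card_univ, Fintype.card_fin]
  simp only [Nat.add_sub_cancel]
  ring

/-- **The bridge**: a `CoefDom` certificate for a family against `(A₀X + a₀)^(n−1)(X + V)` is exactly the coefficient
domination that `TBern` asks of that family. [this work] -/
theorem tbern_le_of_coefDom {n : ℕ} (hn : 0 < n) {s b β V : ℝ} (u vv m : Fin n → ℝ)
    (h : CoefDom (prodPoly univ (fun j => s + (1 - s) * u j) (fun j => (1 - s) * m j + s * vv j))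
      ((C (s + (1 - s) * b) * X + C ((1 - s) * b + s * β)) ^ (n - 1) * (C 1 * X + C V))) (k : ℕ) :
    tcoeff (univ : Finset (Fin n)) (fun j => s + (1 - s) * u j) (fun j => (1 - s) * m j + s * vv j) k ≤
      tcoeff (univ : Finset (Fin n)) (fullFloorA s b) (fullFloorG s b β V) k := by
  rw [← coeff_prodPoly, ← coeff_prodPoly, prodPoly_fullFloor s b β V n hn]
  exact h k

/-- **`TBern` from certificates.**  If every admissible family (the hypotheses of `TBern s b β V`, `n ≥ 1`) admits a
`CoefDom` certificate against `(A₀X + a₀)^(n−1)(X + V)`, then `TBern s b β V` holds (the `n = 0` family is settled by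
the `vv`-budget, which forces `1 ≤ V`). [this work] -/
theorem tbern_of_coefDom {s b β V : ℝ}
    (h : ∀ (n : ℕ) (u vv m : Fin n → ℝ), 0 < n → (∀ j, b ≤ u j) → (∀ j, u j ≤ 1) → (∀ j, β ≤ vv j) →
      (∀ j, vv j ≤ V) → (∀ j, b ≤ m j) → (∀ j, m j ≤ u j) → (∀ j, m j ≤ vv j) →
      ∏ j, u j ≤ b ^ (n - 1) → ∏ j, vv j ≤ β ^ (n - 1) * V →
      ∏ j, ((1 - s) * m j + s * vv j) ≤ ((1 - s) * b + s * β) ^ (n - 1) * V →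
      CoefDom (prodPoly univ (fun j => s + (1 - s) * u j) (fun j => (1 - s) * m j + s * vv j))
        ((C (s + (1 - s) * b) * X + C ((1 - s) * b + s * β)) ^ (n - 1) * (C 1 * X + C V))) :
    TBern s b β V := by
  intro n u vv m hub hu1 hvβ hv1 hmb hmu hmv hpu hpv hpg k
  rcases Nat.eq_zero_or_pos n with hn | hn
  · subst hn
    rw [univ_eq_empty, tcoeff_empty, tcoeff_empty]
  exact tbern_le_of_coefDom hn u vv m (h n u vv m hn hub hu1 hvβ hv1 hmb hmu hmv hpu hpv hpg) k

end LinkedCurrency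

end SafeCalc

end Summit.CriticalPhenomena.PercolationContinuityZ3.Theorems.SunflowerPartition
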